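import Mathlib
import Summits.CriticalPhenomena.PercolationContinuityZ3.Theorems.PercNearOneGluingNoHeavyLowerTailStairKernels
import Summits.CriticalPhenomena.PercolationContinuityZ3.Theorems.PercNearOneGluingNoHeavyLowerTailHurwitzPairPivots
import HarnessLib

/-!
# THEOREM R₂: the operator Hurwitz matrix of two sub-neutral copies is totally nonnegative

Support file for the Sahi / Conjecture-P programme of route `PercNearOneGluingNoHeavy`
(`--supports stmt-CriticalPhenomena-4575`, prover prim-l12-p5 gen 46; proof note
`prim-l12-p5/PROOF-HURWITZ-TRANSFER-g46.md` §2–§3, blueprint `prim-l12-p5/LEAN-BLUEPRINT-3_0-g46.md`).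
No definitions, no named facts, no sorries.

For two copies `φ_j = b_j + g_j X` at level `q > 0` the λ-free band matrix is `W(k,k) = κ₀(k)`,
`W(k,k-1) = κ₁(k)`, `W(k,k-2) = κ₂(k)` with
`κ₀(k) = 1 + (g₁+g₂)k/q + g₁g₂k(k-1)/(q(q+1))`, `κ₁(k) = ((b₁+b₂)k + (b₁g₂+b₂g₁)k(k-1)/(q+1))/q`,
`κ₂(k) = b₁b₂k(k-1)/(q(q+1))`, and its commutator matrix `C = [S,W]` has rows
`C(k,·) = W(k+1,·) - σW(k,·)`, i.e. `C(k,k+1-d) = κ_d(k+1) - κ_d(k)`.  The **operator Hurwitz matrix** is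
the kernel on the doubled index `t` with rows `t = 2k ↦ W(k,·)`, `t = 2k+1 ↦ C(k,·)`.

**THEOREM (`hurwitzPair_tn`).**  For `b₁, b₂ > 0`, `0 < g₁ < 1`, `0 < g₂ ≤ 1`, `q > 0` this kernel is
totally nonnegative.  Proof = the explicit five-stage adjacent-row elimination of the memo: the kernel is
`E₁·E₂·E₃·E₄·E₅·U` with unit lower bidiagonal `E_i` (nonnegative sub-diagonal weights = the
multipliers `μ`) and a generalized diagonal `U`; each stage is `HurwitzPair.step_tn`, the multipliers are
nonnegative by `HurwitzPair.keyPoly_pos` / `boundaryPivot_pos`, and `U` is TN by `StairTN.stairs_minor_nonneg`.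
(`g₁ < 1` excludes the identical-neutral degeneracy; by symmetry one non-neutral copy suffices.)
-/

namespace Summit.CriticalPhenomena.PercolationContinuityZ3.Theorems

namespace HurwitzPair

open Finset Matrix

/-- Lifting row identities to the doubled index: if `X 0 = X' 0`, `X (k+1) = X' (k+1) + eE (k+1) · Y' k`
and `Y k = Y' k + eO k · X' k` (row by row), then the interleaved kernels satisfy
`R t l = R' t l + e t · R' (t-1) l` with `e` = `eE` on even and `eO` on odd `t`. -/
theorem interleave_step (X Y X' Y' : ℕ → ℕ → ℝ) (eE eO : ℕ → ℝ)
    (h0 : ∀ l, X 0 l = X' 0 l) (hE : ∀ k l, X (k + 1) l = X' (k + 1) l + eE (k + 1) * Y' k l)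
    (hO : ∀ k l, Y k l = Y' k l + eO k * X' k l) (heE0 : eE 0 = 0) (t l : ℕ) :
    (if t % 2 = 0 then X (t / 2) l else Y (t / 2) l) =
      (if t % 2 = 0 then X' (t / 2) l else Y' (t / 2) l)
        + (if t % 2 = 0 then eE (t / 2) else eO (t / 2))
          * (if (t - 1) % 2 = 0 then X' ((t - 1) / 2) l else Y' ((t - 1) / 2) l) := by
  rcases Nat.even_or_odd' t with ⟨k, rfl | rfl⟩
  · have h1 : (2 * k) % 2 = 0 := by omega
    have h2 : (2 * k) / 2 = k := by omega
    rw [if_pos h1, if_pos h1, if_pos h1, h2]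
    rcases k with _ | k
    · rw [heE0, zero_mul, add_zero]; exact h0 l
    · have h3 : (2 * (k + 1) - 1) % 2 = 1 := by omega
      have h4 : (2 * (k + 1) - 1) / 2 = k := by omega
      rw [if_neg (by omega), h4]
      exact hE k l
  · have h1 : (2 * k + 1) % 2 = 1 := by omega
    have h2 : (2 * k + 1) / 2 = k := by omega
    have h3 : (2 * k + 1 - 1) % 2 = 0 := by omega
    have h4 : (2 * k + 1 - 1) / 2 = k := by omega
    rw [if_neg (by omega), if_neg (by omega), if_neg (by omega), if_pos h3, h2, h4]
    exact hO k l

/-- **THEOREM R₂.**  The operator Hurwitz matrix (doubled kernel: rows `2k ↦ W(k,·)`, `2k+1 ↦ C(k,·)`)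
of the λ-free band matrix of two sub-neutral integer copies at level `q > 0` is totally nonnegative
(`b₁, b₂ > 0`, `0 < g₁ < 1`, `0 < g₂ ≤ 1`). -/
theorem hurwitzPair_tn (b₁ b₂ g₁ g₂ q : ℝ) (hb₁ : 0 < b₁) (hb₂ : 0 < b₂) (hg₁ : 0 < g₁) (hg₁' : g₁ < 1)
    (hg₂ : 0 < g₂) (hg₂' : g₂ ≤ 1) (hq : 0 < q) (κ₀ κ₁ κ₂ : ℕ → ℝ)
    (hκ₀ : ∀ k : ℕ, κ₀ k = 1 + (g₁ + g₂) * k / q + g₁ * g₂ * ((k : ℝ) * (k - 1)) / (q * (q + 1)))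
    (hκ₁ : ∀ k : ℕ, κ₁ k = ((b₁ + b₂) * k + (b₁ * g₂ + b₂ * g₁) * ((k : ℝ) * (k - 1)) / (q + 1)) / q)
    (hκ₂ : ∀ k : ℕ, κ₂ k = b₁ * b₂ * ((k : ℝ) * (k - 1)) / (q * (q + 1)))
    {m : ℕ} (r c : Fin m → ℕ) (hr : StrictMono r) (hc : StrictMono c) :
    0 ≤ (Matrix.of fun i j =>
      if r i % 2 = 0 then
        (if c j = r i / 2 then κ₀ (r i / 2) else if c j + 1 = r i / 2 then κ₁ (r i / 2)
          else if c j + 2 = r i / 2 then κ₂ (r i / 2) else 0)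
      else
        (if c j = r i / 2 + 1 then κ₀ (r i / 2 + 1) - κ₀ (r i / 2)
          else if c j = r i / 2 then κ₁ (r i / 2 + 1) - κ₁ (r i / 2)
          else if c j + 1 = r i / 2 then κ₂ (r i / 2 + 1) - κ₂ (r i / 2) else 0)).det := by
  have hq1 : 0 < q + 1 := by linarith
  have hB : 0 < b₁ + b₂ := by linarith
  have hG : 0 < g₁ + g₂ := by linarith
  -- differences of the bands
  have hΔ0 : ∀ k : ℕ, κ₀ (k + 1) - κ₀ k = (g₁ + g₂) / q + 2 * g₁ * g₂ * k / (q * (q + 1)) := by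
    intro k; rw [hκ₀, hκ₀]; push_cast; field_simp; ring
  have hΔ1 : ∀ k : ℕ, κ₁ (k + 1) - κ₁ k = (b₁ + b₂) / q + 2 * (b₁ * g₂ + b₂ * g₁) * k / (q * (q + 1)) := by
    intro k; rw [hκ₁, hκ₁]; push_cast; field_simp; ring
  have hΔ2 : ∀ k : ℕ, κ₂ (k + 1) - κ₂ k = 2 * b₁ * b₂ * k / (q * (q + 1)) := by
    intro k; rw [hκ₂, hκ₂]; push_cast; field_simp; ring
  have hκ₀0 : κ₀ 0 = 1 := by rw [hκ₀]; simp
  have hκ₀1 : κ₀ 1 = 1 + (g₁ + g₂) / q := by rw [hκ₀]; simp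
  have hκ₁1 : κ₁ 1 = (b₁ + b₂) / q := by rw [hκ₁]; simp
  have hκ₂1 : κ₂ 1 = 0 := by rw [hκ₂]; simp
  have hκ₁0 : κ₁ 0 = 0 := by rw [hκ₁]; simp
  have hκ₂0 : κ₂ 0 = 0 := by rw [hκ₂]; simp
  have hΔ0pos : ∀ k : ℕ, 0 < κ₀ (k + 1) - κ₀ k := fun k => by rw [hΔ0]; positivity
  have hΔ2nn : ∀ k : ℕ, 0 ≤ κ₂ (k + 1) - κ₂ k := fun k => by rw [hΔ2]; positivity
  -- stage data (memo §3 / blueprint STEP 3)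
  let D0 : ℕ → ℝ := fun k => κ₀ (k + 1) - κ₀ k
  let a1lo : ℕ → ℝ := fun k => if k = 1 then κ₁ 1 else (b₁ + b₂) * k / (2 * q)
  let a1hi : ℕ → ℝ := fun k => if k = 0 then 1 else if k = 1 then κ₀ 1 else 1 + (g₁ + g₂) * k / (2 * q)
  let μB1 : ℕ → ℝ := fun k => if k = 0 then 0 else (κ₂ (k + 1) - κ₂ k) / a1lo k
  let 𝒞 : ℕ → ℝ := fun k => (κ₁ (k + 1) - κ₁ k) - μB1 k * a1hi k
  let μA2 : ℕ → ℝ := fun k => if k = 0 then 0 else a1lo k / 𝒞 (k - 1)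
  let ŵ : ℕ → ℝ := fun k => a1hi k - μA2 k * D0 (k - 1)
  -- unfolding facts for the stage data
  have hD0 : ∀ k, D0 k = κ₀ (k + 1) - κ₀ k := fun k => rfl
  have a1lo1 : a1lo 1 = κ₁ 1 := if_pos rfl
  have a1lo_ge : ∀ k, k ≠ 1 → a1lo k = (b₁ + b₂) * k / (2 * q) := fun k hk => if_neg hk
  have a1hi0 : a1hi 0 = 1 := if_pos rfl
  have a1hi1 : a1hi 1 = κ₀ 1 := by
    show (if (1 : ℕ) = 0 then (1 : ℝ) else if (1 : ℕ) = 1 then κ₀ 1 else 1 + (g₁ + g₂) * ((1 : ℕ) : ℝ) / (2 * q)) = κ₀ 1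
    rw [if_neg one_ne_zero, if_pos rfl]
  have a1hi_ge : ∀ k, 2 ≤ k → a1hi k = 1 + (g₁ + g₂) * k / (2 * q) := by
    intro k hk
    show (if k = 0 then (1 : ℝ) else if k = 1 then κ₀ 1 else 1 + (g₁ + g₂) * (k : ℝ) / (2 * q)) = _
    rw [if_neg (by omega), if_neg (by omega)]
  have μB1_0 : μB1 0 = 0 := if_pos rfl
  have μB1_ne : ∀ k, k ≠ 0 → μB1 k = (κ₂ (k + 1) - κ₂ k) / a1lo k := fun k hk => if_neg hk
  have h𝒞def : ∀ k, 𝒞 k = (κ₁ (k + 1) - κ₁ k) - μB1 k * a1hi k := fun k => rfl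
  have μA2_0 : μA2 0 = 0 := if_pos rfl
  have μA2_ne : ∀ k, k ≠ 0 → μA2 k = a1lo k / 𝒞 (k - 1) := fun k hk => if_neg hk
  have hŵdef : ∀ k, ŵ k = a1hi k - μA2 k * D0 (k - 1) := fun k => rfl
  -- positivity of the pivots
  have ha1lo : ∀ k, 1 ≤ k → 0 < a1lo k := by
    intro k hk
    by_cases h1 : k = 1
    · rw [h1, a1lo1, hκ₁1]; positivity
    · rw [a1lo_ge k h1]
      have : (0 : ℝ) < k := by exact_mod_cast hk
      positivity
  have ha1hi : ∀ k, 0 < a1hi k := by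
    intro k
    rcases Nat.lt_or_ge k 2 with hk | hk
    · interval_cases k
      · rw [a1hi0]; exact one_pos
      · rw [a1hi1, hκ₀1]; positivity
    · rw [a1hi_ge k hk]; positivity
  have hμB1nn : ∀ k, 0 ≤ μB1 k := by
    intro k
    by_cases h0 : k = 0
    · rw [h0, μB1_0]
    · rw [μB1_ne k h0]; exact div_nonneg (hΔ2nn k) (ha1lo k (by omega)).le
  -- 𝒞 in closed form
  have h𝒞0 : 𝒞 0 = (b₁ + b₂) / q := by
    rw [h𝒞def, μB1_0, zero_mul, sub_zero, hΔ1]; simp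
  have h𝒞1 : 𝒞 1 = (q * (b₁ ^ 2 + b₂ ^ 2) + (b₁ + b₂) ^ 2 + 2 * (b₁ ^ 2 * g₂ + b₂ ^ 2 * g₁))
      / (q * (b₁ + b₂) * (q + 1)) := by
    rw [h𝒞def, μB1_ne 1 one_ne_zero, a1lo1, a1hi1, hΔ1, hΔ2, hκ₁1, hκ₀1]; push_cast
    field_simp; ring
  have h𝒞ge2 : ∀ k : ℕ, 2 ≤ k → 𝒞 k = ((b₁ + b₂) ^ 2 + q * (b₁ - b₂) ^ 2
      + 2 * k * (b₁ ^ 2 * g₂ + b₂ ^ 2 * g₁)) / (q * (b₁ + b₂) * (q + 1)) := by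
    intro k hk
    have hk0 : (k : ℝ) ≠ 0 := by exact_mod_cast (show k ≠ 0 by omega)
    rw [h𝒞def, μB1_ne k (by omega), a1lo_ge k (by omega), a1hi_ge k hk, hΔ1, hΔ2]
    field_simp; ring
  have h𝒞pos : ∀ k, 0 < 𝒞 k := by
    intro k
    rcases Nat.lt_or_ge k 2 with hk | hk
    · interval_cases k
      · rw [h𝒞0]; positivity
      · rw [h𝒞1]; positivity
    · rw [h𝒞ge2 k hk]
      have : 0 ≤ (k : ℝ) := by positivity
      positivity
  have hμA2nn : ∀ k, 0 ≤ μA2 k := by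
    intro k
    by_cases h0 : k = 0
    · rw [h0, μA2_0]
    · rw [μA2_ne k h0]; exact div_nonneg (ha1lo k (by omega)).le (h𝒞pos _).le
  -- ŵ: small values and closed forms
  have hŵ0 : ŵ 0 = 1 := by rw [hŵdef, a1hi0, μA2_0, zero_mul, sub_zero]
  have hŵ1 : ŵ 1 = 1 := by
    rw [hŵdef, a1hi1, μA2_ne 1 one_ne_zero, a1lo1, Nat.sub_self, h𝒞0, hκ₁1,
      div_self (div_pos hB hq).ne', one_mul, hD0, zero_add, hκ₀0]; ring
  have hŵ2 : ŵ 2 * (q * (q * (b₁ ^ 2 + b₂ ^ 2) + (b₁ + b₂) ^ 2 + 2 * (b₁ ^ 2 * g₂ + b₂ ^ 2 * g₁)))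
      = q ^ 2 * (b₁ ^ 2 + b₂ ^ 2)
        + q * (b₁ ^ 2 * (1 + 2 * g₂) + b₂ ^ 2 * (1 + 2 * g₁) + 2 * b₁ * b₂ * (1 - g₁ - g₂))
        + 2 * (b₁ * g₂ - b₂ * g₁) ^ 2 := by
    have h21 : (2 : ℕ) - 1 = 1 := rfl
    rw [hŵdef, a1hi_ge 2 le_rfl, μA2_ne 2 (by omega), a1lo_ge 2 (by omega), h21, h𝒞1, hD0, hΔ0]
    push_cast
    have hnum : q * (b₁ ^ 2 + b₂ ^ 2) + (b₁ + b₂) ^ 2 + 2 * (b₁ ^ 2 * g₂ + b₂ ^ 2 * g₁) ≠ 0 := by positivity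
    field_simp; ring
  have hŵge3 : ∀ k : ℕ, 3 ≤ k → ŵ k * (2 * q * ((b₁ + b₂) ^ 2 + q * (b₁ - b₂) ^ 2
      + 2 * ((k : ℝ) - 1) * (b₁ ^ 2 * g₂ + b₂ ^ 2 * g₁)))
      = 2 * q * (q * (b₁ - b₂) ^ 2 + (b₁ + b₂) ^ 2 - 2 * (b₁ ^ 2 * g₂ + b₂ ^ 2 * g₁))
        + 4 * q * (b₁ - b₂) * (b₁ * g₂ - b₂ * g₁) * k + 2 * (b₁ * g₂ - b₂ * g₁) ^ 2 * (k * ((k : ℝ) - 1)) := by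
    intro k hk
    obtain ⟨j, rfl⟩ : ∃ j, k = j + 3 := ⟨k - 3, by omega⟩
    have h1 : j + 3 - 1 = j + 2 := by omega
    rw [hŵdef, a1hi_ge (j + 3) (by omega), μA2_ne (j + 3) (by omega), a1lo_ge (j + 3) (by omega), h1,
      h𝒞ge2 (j + 2) (by omega), hD0, hΔ0]
    push_cast
    have hden : (b₁ + b₂) ^ 2 + q * (b₁ - b₂) ^ 2 + 2 * ((j : ℝ) + 2) * (b₁ ^ 2 * g₂ + b₂ ^ 2 * g₁) ≠ 0 := by
      positivity
    field_simp; ring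
  have hŵpos : ∀ k, 0 < ŵ k := by
    intro k
    rcases Nat.lt_or_ge k 3 with hk | hk
    · interval_cases k
      · rw [hŵ0]; exact one_pos
      · rw [hŵ1]; exact one_pos
      · have hpos := boundaryPivot_pos b₁ b₂ g₁ g₂ q hb₁ hb₂ hg₁.le hg₁'.le hg₂.le hg₂' hq
        rw [← hŵ2] at hpos
        exact pos_of_mul_pos_left hpos (by positivity)
    · have hk1 : (1 : ℝ) ≤ k := by exact_mod_cast (show 1 ≤ k by omega)
      have hpos := keyPoly_pos b₁ b₂ g₁ g₂ q k hb₁ hb₂ hg₁ hg₁' hg₂ hg₂' hq hk1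
      rw [← hŵge3 k hk] at hpos
      have hkm : (0 : ℝ) ≤ (k : ℝ) - 1 := by linarith
      exact pos_of_mul_pos_left hpos (by positivity)
  -- the row kernels of the five stages
  let rowW : ℕ → ℕ → ℝ := fun k l =>
    if l = k then κ₀ k else if l + 1 = k then κ₁ k else if l + 2 = k then κ₂ k else 0
  let rowC : ℕ → ℕ → ℝ := fun k l =>
    if l = k + 1 then κ₀ (k + 1) - κ₀ k else if l = k then κ₁ (k + 1) - κ₁ k
      else if l + 1 = k then κ₂ (k + 1) - κ₂ k else 0
  let A1 : ℕ → ℕ → ℝ := fun k l => if l = k then a1hi k else if l + 1 = k then a1lo k else 0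
  let B1 : ℕ → ℕ → ℝ := fun k l => if l = k then 𝒞 k else if l = k + 1 then D0 k else 0
  let A2 : ℕ → ℕ → ℝ := fun k l => if l = k then ŵ k else 0
  let B2 : ℕ → ℕ → ℝ := fun k l => if l = k + 1 then D0 k else 0
  let A3 : ℕ → ℕ → ℝ := fun k l => if k = 0 ∧ l = 0 then 1 else 0
  -- stage identities, row by row (values depend on k only; l enters through the conditions)
  have hqne : q ≠ 0 := hq.ne'
  have hq1ne : q + 1 ≠ 0 := hq1.ne'
  have hBne : b₁ + b₂ ≠ 0 := hB.ne'
  have I1zero : ∀ l, rowW 0 l = A1 0 l := by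
    intro l; simp only [rowW, A1, a1hi, hκ₀0]
    split_ifs <;> first | rfl | (exfalso; omega)
  have I1E : ∀ k l, rowW (k + 1) l =
      A1 (k + 1) l + (if k + 1 ≤ 1 then 0 else ((k + 1 : ℕ) : ℝ) / 2) * rowC k l := by
    intro k l
    rcases Nat.eq_zero_or_pos k with rfl | hk
    · simp only [rowW, rowC, A1, a1hi, a1lo, zero_add, if_pos (le_refl 1), zero_mul, add_zero,
        if_neg one_ne_zero]
      split_ifs <;> first | rfl | (exfalso; omega)
    · simp only [rowW, rowC, A1, a1hi, a1lo, if_neg (show ¬ (k + 1 ≤ 1) by omega),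
        if_neg (show k + 1 ≠ 0 by omega), if_neg (show k + 1 ≠ 1 by omega)]
      split_ifs <;> first | (exfalso; omega) | skip
      · rw [hΔ0, hκ₀]; push_cast; field_simp; ring
      · rw [hΔ1, hκ₁]; push_cast; field_simp; ring
      · rw [hΔ2, hκ₂]; push_cast; field_simp; ring
      · ring
  have I2 : ∀ k l, rowC k l = B1 k l + μB1 k * A1 k l := by
    intro k l
    simp only [rowC, B1, A1]
    split_ifs <;> first | (exfalso; omega) | skip
    · ring
    · simp only [𝒞]; ring
    · have hk : k ≠ 0 := by omega
      simp only [μB1, if_neg hk]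
      rw [zero_add, div_mul_cancel₀ _ (ha1lo k (by omega)).ne']
    · ring
  have I3zero : ∀ l, A1 0 l = A2 0 l := by
    intro l; simp only [A1, A2, a1hi, hŵ0]
    split_ifs <;> first | rfl | (exfalso; omega)
  have I3E : ∀ k l, A1 (k + 1) l = A2 (k + 1) l + μA2 (k + 1) * B1 k l := by
    intro k l
    simp only [A1, A2, B1]
    split_ifs <;> first | (exfalso; omega) | skip
    · simp only [ŵ, Nat.add_sub_cancel]; ring
    · simp only [μA2, if_neg (show k + 1 ≠ 0 by omega), Nat.add_sub_cancel]
      rw [zero_add, div_mul_cancel₀ _ (h𝒞pos k).ne']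
    · ring
  have I4 : ∀ k l, B1 k l = B2 k l + (𝒞 k / ŵ k) * A2 k l := by
    intro k l
    simp only [B1, B2, A2]
    split_ifs <;> first | (exfalso; omega) | skip
    · rw [zero_add, div_mul_cancel₀ _ (hŵpos k).ne']
    · ring
    · ring
  have I5zero : ∀ l, A2 0 l = A3 0 l := by
    intro l; simp only [A2, A3, hŵ0, true_and]
  have I5E : ∀ k l, A2 (k + 1) l = A3 (k + 1) l + (ŵ (k + 1) / D0 k) * B2 k l := by
    intro k l
    simp only [A2, A3, B2, if_neg (show ¬ (k + 1 = 0 ∧ l = 0) by omega), zero_add]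
    split_ifs
    · rw [div_mul_cancel₀ _ (hΔ0pos k).ne']
    · rw [mul_zero]
  -- total nonnegativity, stage by stage (from U = (A3 | B2) back to (rowW | rowC))
  let R5 : ℕ → ℕ → ℝ := fun t l => if t % 2 = 0 then A3 (t / 2) l else B2 (t / 2) l
  let R4 : ℕ → ℕ → ℝ := fun t l => if t % 2 = 0 then A2 (t / 2) l else B2 (t / 2) l
  let R3 : ℕ → ℕ → ℝ := fun t l => if t % 2 = 0 then A2 (t / 2) l else B1 (t / 2) l
  let R2 : ℕ → ℕ → ℝ := fun t l => if t % 2 = 0 then A1 (t / 2) l else B1 (t / 2) l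
  let R1 : ℕ → ℕ → ℝ := fun t l => if t % 2 = 0 then A1 (t / 2) l else rowC (t / 2) l
  let e5 : ℕ → ℝ := fun t => if t % 2 = 0 then (if t / 2 = 0 then 0 else ŵ (t / 2) / D0 (t / 2 - 1)) else 0
  let e4 : ℕ → ℝ := fun t => if t % 2 = 0 then 0 else 𝒞 (t / 2) / ŵ (t / 2)
  let e3 : ℕ → ℝ := fun t => if t % 2 = 0 then μA2 (t / 2) else 0
  let e2 : ℕ → ℝ := fun t => if t % 2 = 0 then 0 else μB1 (t / 2)
  let e1 : ℕ → ℝ := fun t => if t % 2 = 0 then (if t / 2 ≤ 1 then 0 else ((t / 2 : ℕ) : ℝ) / 2) else 0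
  have T5 : ∀ (k' : ℕ) (r' c' : Fin k' → ℕ), StrictMono r' → StrictMono c' →
      0 ≤ (Matrix.of fun i j => R5 (r' i) (c' j)).det := by
    intro k' r' c' hr' hc'
    refine StairTN.stairs_minor_nonneg R5 (fun t => (t + 1) / 2) (fun t => (t + 1) / 2)
      (fun _ => le_rfl) (fun t => by omega) ?_ ?_ ?_ r' c' hr' hc'
    · intro t l
      show 0 ≤ (if t % 2 = 0 then A3 (t / 2) l else B2 (t / 2) l)
      by_cases h : t % 2 = 0
      · rw [if_pos h]; show 0 ≤ (if t / 2 = 0 ∧ l = 0 then (1 : ℝ) else 0); split_ifs <;> norm_num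
      · rw [if_neg h]; show 0 ≤ (if l = t / 2 + 1 then D0 (t / 2) else 0); split_ifs
        · exact (hΔ0pos _).le
        · exact le_rfl
    · intro t l hl
      show (if t % 2 = 0 then A3 (t / 2) l else B2 (t / 2) l) = 0
      by_cases h : t % 2 = 0
      · rw [if_pos h]; exact if_neg (by omega)
      · rw [if_neg h]; exact if_neg (by omega)
    · intro t l hl
      show (if t % 2 = 0 then A3 (t / 2) l else B2 (t / 2) l) = 0
      by_cases h : t % 2 = 0
      · rw [if_pos h]; exact if_neg (by omega)
      · rw [if_neg h]; exact if_neg (by omega)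
  have T4 : ∀ (k' : ℕ) (r' c' : Fin k' → ℕ), StrictMono r' → StrictMono c' →
      0 ≤ (Matrix.of fun i j => R4 (r' i) (c' j)).det := by
    intro k' r' c' hr' hc'
    have heq : (Matrix.of fun i j => R4 (r' i) (c' j)) =
        Matrix.of fun i j => R5 (r' i) (c' j) + e5 (r' i) * R5 (r' i - 1) (c' j) := by
      ext i j
      exact interleave_step A2 B2 A3 B2 (fun k => if k = 0 then 0 else ŵ k / D0 (k - 1)) (fun _ => 0)
        I5zero (fun k l => by rw [if_neg (by omega), Nat.add_sub_cancel]; exact I5E k l)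
        (fun k l => by ring) (if_pos rfl) (r' i) (c' j)
    rw [heq]
    refine step_tn R5 e5 (fun t => ?_) ?_ T5 r' c' hr' hc'
    · show 0 ≤ (if t % 2 = 0 then (if t / 2 = 0 then 0 else ŵ (t / 2) / D0 (t / 2 - 1)) else 0)
      split_ifs
      · exact le_rfl
      · exact div_nonneg (hŵpos _).le (hΔ0pos _).le
      · exact le_rfl
    · show (if 0 % 2 = 0 then (if 0 / 2 = 0 then (0:ℝ) else ŵ (0 / 2) / D0 (0 / 2 - 1)) else 0) = 0
      rw [if_pos rfl, if_pos rfl]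
  have T3 : ∀ (k' : ℕ) (r' c' : Fin k' → ℕ), StrictMono r' → StrictMono c' →
      0 ≤ (Matrix.of fun i j => R3 (r' i) (c' j)).det := by
    intro k' r' c' hr' hc'
    have heq : (Matrix.of fun i j => R3 (r' i) (c' j)) =
        Matrix.of fun i j => R4 (r' i) (c' j) + e4 (r' i) * R4 (r' i - 1) (c' j) := by
      ext i j
      exact interleave_step A2 B1 A2 B2 (fun _ => 0) (fun k => 𝒞 k / ŵ k)
        (fun l => rfl) (fun k l => by ring) I4 rfl (r' i) (c' j)
    rw [heq]
    refine step_tn R4 e4 (fun t => ?_) ?_ T4 r' c' hr' hc'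
    · show 0 ≤ (if t % 2 = 0 then (0:ℝ) else 𝒞 (t / 2) / ŵ (t / 2))
      split_ifs
      · exact le_rfl
      · exact div_nonneg (h𝒞pos _).le (hŵpos _).le
    · exact if_pos rfl
  have T2 : ∀ (k' : ℕ) (r' c' : Fin k' → ℕ), StrictMono r' → StrictMono c' →
      0 ≤ (Matrix.of fun i j => R2 (r' i) (c' j)).det := by
    intro k' r' c' hr' hc'
    have heq : (Matrix.of fun i j => R2 (r' i) (c' j)) =
        Matrix.of fun i j => R3 (r' i) (c' j) + e3 (r' i) * R3 (r' i - 1) (c' j) := by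
      ext i j
      exact interleave_step A1 B1 A2 B1 μA2 (fun _ => 0) I3zero I3E (fun k l => by ring) μA2_0 (r' i) (c' j)
    rw [heq]
    refine step_tn R3 e3 (fun t => ?_) ?_ T3 r' c' hr' hc'
    · show 0 ≤ (if t % 2 = 0 then μA2 (t / 2) else 0)
      split_ifs
      · exact hμA2nn _
      · exact le_rfl
    · show (if 0 % 2 = 0 then μA2 (0 / 2) else 0) = 0
      rw [if_pos rfl]; exact μA2_0
  have T1 : ∀ (k' : ℕ) (r' c' : Fin k' → ℕ), StrictMono r' → StrictMono c' →
      0 ≤ (Matrix.of fun i j => R1 (r' i) (c' j)).det := by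
    intro k' r' c' hr' hc'
    have heq : (Matrix.of fun i j => R1 (r' i) (c' j)) =
        Matrix.of fun i j => R2 (r' i) (c' j) + e2 (r' i) * R2 (r' i - 1) (c' j) := by
      ext i j
      exact interleave_step A1 rowC A1 B1 (fun _ => 0) μB1 (fun l => rfl) (fun k l => by ring) I2 rfl (r' i) (c' j)
    rw [heq]
    refine step_tn R2 e2 (fun t => ?_) ?_ T2 r' c' hr' hc'
    · show 0 ≤ (if t % 2 = 0 then (0:ℝ) else μB1 (t / 2))
      split_ifs
      · exact le_rfl
      · exact hμB1nn _
    · exact if_pos rfl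
  -- the last stage: (rowW | rowC) = E₁ · (A1 | rowC)
  have heq : (Matrix.of fun i j =>
      if r i % 2 = 0 then
        (if c j = r i / 2 then κ₀ (r i / 2) else if c j + 1 = r i / 2 then κ₁ (r i / 2)
          else if c j + 2 = r i / 2 then κ₂ (r i / 2) else 0)
      else
        (if c j = r i / 2 + 1 then κ₀ (r i / 2 + 1) - κ₀ (r i / 2)
          else if c j = r i / 2 then κ₁ (r i / 2 + 1) - κ₁ (r i / 2)
          else if c j + 1 = r i / 2 then κ₂ (r i / 2 + 1) - κ₂ (r i / 2) else 0)) =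
      Matrix.of fun i j => R1 (r i) (c j) + e1 (r i) * R1 (r i - 1) (c j) := by
    ext i j
    exact interleave_step rowW rowC A1 rowC (fun k => if k ≤ 1 then 0 else ((k : ℕ) : ℝ) / 2) (fun _ => 0)
      I1zero I1E (fun k l => by ring) (if_pos (by omega)) (r i) (c j)
  rw [heq]
  refine step_tn R1 e1 (fun t => ?_) ?_ T1 r c hr hc
  · show 0 ≤ (if t % 2 = 0 then (if t / 2 ≤ 1 then 0 else ((t / 2 : ℕ) : ℝ) / 2) else 0)
    split_ifs
    · exact le_rfl
    · positivity
    · exact le_rfl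
  · show (if 0 % 2 = 0 then (if 0 / 2 ≤ 1 then (0:ℝ) else ((0 / 2 : ℕ) : ℝ) / 2) else 0) = 0
    rw [if_pos rfl, if_pos (by omega)]

end HurwitzPair

end Summit.CriticalPhenomena.PercolationContinuityZ3.Theorems
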